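import Summits.BirchSwinnertonDyer.BirchSwinnertonDyer.Theorems.SchneiderFreeAdditiveX3KYBranchThreeDoorBROfTree
import HarnessLib

/-!
# Route `SchneiderFreeAdditiveX3` (K1 door): the `p = 3` NON-ANOMALOUS column WITHOUT [BR3], part 3 — the (G-ord, `e = 2`) lower socket per datum and
# crux r3's own currency on the non-anomalous pairs at `p = 3`, the comparison datum AUX3 now CARRYING the Rubin–Hida λ-clauses of its residual pair
# (FILE 3 of generation 42's [BR3] re-key; twins of generation 40's F39b §1–§2 `KYBranchThreeDoorOfCGLS`)

Cell `bsd-schneider-ideate`, seat `bsd-schneider-door-c5` (prover, generation 42; assembly layer; `--supports` 19177).  PARTITION: board row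
B6 ∩ X3 ∩ sst-twist, `r = 1`, (G-ord, `e = 2`) half at `p = 3`, NON-ANOMALOUS twist (686 of 2 411 pairs; class-wide) of `Rank1Residual.partition` —
ASSEMBLY; types-the-object-of nothing new; RE-KEYS F39b's `additiveIMCLowerBDPOnTree_subGordTwo_three_offSliver_self` / `_of_torsionFree` / `_offSliver` /
`_of_thm212` / `additiveIMCLowerBDPInputManinAt_gordTwo_three_of_print_of_forall_twist` off the named fact [BR3] `KellerYin2024.thm122_charLambda_pair_three`:
the existential comparison datum `hAUX` gains `n_φ` with `FirstUnitCoeffAt Lφ n_φ` and the two λ-clauses `λ(G.X) = n_φ` (strict primitive duals of both members),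
supplied by FILE 1's AUX3-BR (`KYBranchThreeBROfTree.exists_aux3br_of_thm212`: cell `bsd-eis`'s [BR𝟙]/[BRω] roads — Bleher et al. 2020 Thm. 3.3.1, de Shalit II.6.4,
Hida Thm. I on the tree's Milne ADT I Thm. 4.10 (a) — and the UNCONDITIONAL `grSelmer = unrSelmer` transfer) and consumed by FILE 2's H3♭ᶜ.  Proofs token-identical
to F39b with that threading; closes none of B6's cells (BSD NOT advanced).  bears_on: K1-door (19177 r3 `GordTwoBranchIMC`).

INPUT LEDGER of crux r3's `p = 3` NON-ANOMALOUS sub-column (crux currency) after this file: {Kolyvagin, Par, Hsieh A, LZZ, Castella–Hsieh signed} ∪ {[DIV.dvd] PRE,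
[AN3] PUB-composed, CGLS Thm. 2.1.2} ∪ {CGLS Prop. 1.2.5 (module clause; corank clause), Prop. 14, Cor. 1.2.6 (i)(ii)} ∪ {Bleher et al. 3.3.1, de Shalit II.6.4,
Hida Thm. I} ∪ {Milne ADT I Thm. 4.10 (a) (tree)} — [BR3] GONE (it was this seat's generation-26 λ-currency typing of CGLS Thm. 1.2.2; its content at the
door's data is now a tree theorem modulo three refereed statements the anomalous column already displays).
HONEST FRAMING: compositions of tree theorems, CONDITIONAL BY NAME on the displayed statements ([DIV.dvd], [AN3] carry Keller–Yin claim tags); no definition,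
no named fact, no `sorry`; nothing is closed; BSD proved for no curve; «closes rung: none».  References: [KellerYin2024b] Thm. 3.3.6, Prop. 3.4.4, §3.5, Thm.
3.5.1, Assumption 2.0.3; [CastellaGrossiLeeSkinner2022] Thms. 1.2.2, 2.1.2, 2.2.2, Props. 1.2.5, 14, Cor. 1.2.6; [BleherEtAl2020] Thm. 3.3.1; [deShalit1987]
II.6.4; [Hida2010MuInvariant] Thm. I; [MilneADT2006] I Thm. 4.10 (a); [CastellaHsieh2018] §3.3; [Hsieh2014] Thm. A; [LiuZhangZhang2018] Thms. 1.5.1/1.5.3;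
this seat p680959 / p682313 / p684036 / p685220 / p686186 (gens 26–27), p755440 (F39b), FILES 1–2 (gen 42).
-/

set_option autoImplicit false
set_option linter.dupNamespace false -- the summit namespace `…BirchSwinnertonDyer.BirchSwinnertonDyer.Theorems` (Sub = Summit, D-0017) trips it

noncomputable section

open scoped Classical NumberField Pointwise

open Field NumberField IsDedekindDomain WeierstrassCurve PowerSeries Rat.HeightOneSpectrum
  Literature.NumberTheory.EllipticCurves Literature.NumberTheory.EllipticCurves.GreenbergSelmer
  Literature.NumberTheory.GaloisRepresentations Literature.NumberTheory.GaloisCohomology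
  Literature.NumberTheory.EllipticCurves.ModularForms Literature.NumberTheory.EllipticCurves.Rank1Residual
  Literature.NumberTheory.EllipticCurves.Rank1Residual.Typed
  Literature.NumberTheory.EllipticCurves.KellerYin2024 Literature.NumberTheory.EllipticCurves.CaiShuTian2014
  Literature.NumberTheory.QuadraticFields
  Literature.NumberTheory.IwasawaTheory Literature.NumberTheory.IwasawaTheory.Greenberg2016 Literature.NumberTheory.IwasawaTheory.Greenberg2006
  Literature.NumberTheory.EllipticCurves.Rubin1991 Literature.NumberTheory.EllipticCurves.DeShalit1987
  Literature.NumberTheory.EllipticCurves.Hida2010MuInvariant Literature.NumberTheory.EllipticCurves.BCGKPST2020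
  Summit.BirchSwinnertonDyer.Rank1Residual Summit.BirchSwinnertonDyer.Rank1Residual.X11b
  Summit.BirchSwinnertonDyer.Rank1Residual.X11b.Halves
  Summit.BirchSwinnertonDyer.Rank1Residual.X11b.CongruenceLimit Summit.BirchSwinnertonDyer.Rank1Residual.Additive
  Summit.BirchSwinnertonDyer.BirchSwinnertonDyer.Theorems.SchneiderFree
  Summit.BirchSwinnertonDyer.BirchSwinnertonDyer.Theorems.SchneiderFree.Upper
  Summit.BirchSwinnertonDyer.BirchSwinnertonDyer.Theorems.SchneiderFree.KYRead
  Summit.BirchSwinnertonDyer.BirchSwinnertonDyer.Theorems.SchneiderFree.GoodMember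
  Summit.BirchSwinnertonDyer.BirchSwinnertonDyer.Theses.SchneiderFreeAdditiveX3
  Summit.BirchSwinnertonDyer.BirchSwinnertonDyer.Theorems.SchneiderFreeAdditiveX3.LZZMatch
  Summit.BirchSwinnertonDyer.BirchSwinnertonDyer.Theorems.SchneiderFreeAdditiveX3.ControlDischarged
  Summit.BirchSwinnertonDyer.BirchSwinnertonDyer.Theorems.SchneiderFreeAdditiveX3.KYBranchOnly
  Summit.BirchSwinnertonDyer.BirchSwinnertonDyer.Theorems.SchneiderFreeAdditiveX3.KYNonAnomalousTwist
  Summit.BirchSwinnertonDyer.BirchSwinnertonDyer.Theorems.SchneiderFreeAdditiveX3.UpperOfPrintNonAnomalousTwist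
  Summit.BirchSwinnertonDyer.BirchSwinnertonDyer.Theorems.EisensteinPrimesMuLambda
  Summit.BirchSwinnertonDyer.BirchSwinnertonDyer.Theorems.TeichmullerPairUnramifiedAtMult
  Summit.BirchSwinnertonDyer.BirchSwinnertonDyer.Theorems.KatzLineFrame
open Literature.NumberTheory.EllipticCurves.CastellaGrossiLeeSkinner2022
  (cor126_residualCharacter_globalLift cor126_residualCharacter_localSurjective
    prop125_characterGrSelmerDual_torsion_muZero_dim prop125_characterGrSelmerDual_corank_ge prop14_residualCharacterSelmer_finite
    thm212_exists_isKatzLFunction IsKatzLFunction)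

namespace Summit.BirchSwinnertonDyer.BirchSwinnertonDyer.Theorems.SchneiderFreeAdditiveX3.KYBranchThreeDoorBROfTree

open Summit.BirchSwinnertonDyer.Rank1Residual.X11b.AcSelmer
  Summit.BirchSwinnertonDyer.BirchSwinnertonDyer.Theorems.SchneiderFreeAdditiveX3.KYBranchThreeOfCGLS

/-- **The (G-ord, `e = 2`) lower socket AT `p = 3`, OFF the `d_K = −3` sliver, for a Keller–Yin-normalised curve with non-anomalous twists, Greenberg-free and [BR3]-free** (the comparison datum now CARRIES the Rubin–Hida λ-clauses of its residual pair; FILE 2's H3♭ᶜ) —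
generation 26's `KYBranchThreeDoor.additiveIMCLowerBDPOnTree_subGordTwo_three_offSliver_self` with its last step on the H3♭ᶜ above (per-curve data `hlat`, `htf` and
the comparison datum displayed). [claim: KellerYin2024PotOrd, status: under-review]
[cite: KellerYin2024b, Thm. 3.3.6, Prop. 3.4.4, Thm. 3.5.1, Rem. 3.5.2, Assumption 2.0.3 (arXiv:2410.23241 pp. 8, 19–20) (preprint; the Kolyvagin clause a hypothesis)]
[cite: Hsieh2014, Thm. A p. 712] [cite: LiuZhangZhang2018, Thm 1.5.1 and Thm 1.5.3] [cite: CastellaGrossiLeeSkinner2022, Thms. 1.2.2, 2.1.2, Props. 1.2.5, 14] [cite: MilneADT2006, I Thm. 4.10 (a)] -/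
theorem additiveIMCLowerBDPOnTree_subGordTwo_three_offSliver_self
    (hKo : ∀ (N : ℕ) [NeZero N] (W : WeierstrassCurve ℚ) (K : Type) [Field K] [NumberField K],
      Literature.NumberTheory.EllipticCurves.kolyvagin N W K)
    (hPar : nonempty_modularParametrizationData)
    (hA : Hsieh2014.thmA_exists_isHsiehLFunction_unrPeriod_anyLevel)
    (hL : LiuZhangZhang2018.thm151_thm153_modularCurve_heegnerVector_additive)
    (hCHσ : castellaHsieh2018_exists_isBranchBDPLFunction_signed)
    (hDVD : thm336_dvd_branch_OPEN) (hAN : thm351_anacong_branch_three)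
    (hprop125 : prop125_characterGrSelmerDual_torsion_muZero_dim) (hge : prop125_characterGrSelmerDual_corank_ge) (hfact : prop14_residualCharacterSelmer_finite)
    (hlift : cor126_residualCharacter_globalLift) (hlocal : cor126_residualCharacter_localSurjective)
    (hPT : ∀ (L : Type) [Field L] [NumberField L] [IsTotallyComplex L] (S : Set (HeightOneSpectrum (𝓞 L))),
      S.Finite → Literature.NumberTheory.GaloisCohomology.poitouTate_shaRestricted_tateDual_natural_at L S) :
    ∀ (W : WeierstrassCurve ℚ) [W.IsElliptic] [W.IsGloballyMinimal],
      W.analyticRank = 1 → ClassX3 W 3 → SubGordTwo W 3 →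
      (∀ (V : WeierstrassCurve ℚ) [V.IsElliptic] [V.IsGloballyMinimal] (C : VariableChange ℚ),
        GoodOrd V 3 → C • V.quadraticTwist ((-1 : ℚ) ^ (3 / 2) * (3 : ℕ)) = W → ¬ (3 : ℤ) ∣ V.frobeniusTrace 3 - 1) →
      (∃ Φ : AddSubgroup (geomTorsion W (3 : ℤ)), IsRationalLine W 3 Φ ∧ ¬ LineDecompositionTrivialAt W 3 Φ) →
      ∀ (N : ℕ) [NeZero N] (K : Type) [Field K] [NumberField K]
        (Dt : ModularParametrizationData W N) (H : HeegnerDatum N (NumberField.discr K)) (ι : K →+* ℂ)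
        (P : (W.baseChange K).toAffine.Point),
        W.analyticRank = 1 → Additive.N10.Locus W 3 → W.conductorNorm ℤ = N → IsImaginaryQuadratic K →
        Odd (NumberField.discr K) → ¬ 3 ∣ Units.torsionOrder K → SatisfiesHeegnerHypothesis N K →
        (W.quadraticTwist (NumberField.discr K : ℚ)).entireLFunction 1 ≠ 0 →
        WeierstrassCurve.Affine.Point.map ι.toRatAlgHom P = heegnerPointComplex Dt H →
        ¬ IsOfFinAddOrder P → NumberField.discr K ≠ -3 →
        (∀ Q : (W.baseChange K).toAffine.Point, 3 • Q = 0 → Q = 0) →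
        ∀ (κ : ZpExtension K 3), κ.IsAnticyclotomic →
          ∀ (γ : Field.absoluteGaloisGroup K) [Fact (κ.IsTopGenerator γ)]
            (𝔭 : HeightOneSpectrum (𝓞 K)) (h𝔭 : ((3 : ℕ) : 𝓞 K) ∈ 𝔭.asIdeal)
            (he : 𝔭.asIdeal.ramificationIdx (𝓞 ℚ) = 1) (hf : 𝔭.asIdeal.inertiaDeg (𝓞 ℚ) = 1),
            -- the analytic comparison data WITH the Rubin–Hida λ-clauses at every conjugate prime and every embedding datum inducing it (AUX3-BR)
            (∀ (𝔮 : HeightOneSpectrum (𝓞 K)), ((3 : ℕ) : 𝓞 K) ∈ 𝔮.asIdeal → 𝔭 ≠ 𝔮 →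
              ∀ (ι' : PadicAlgCl 3 ≃+* ℂ), BranchInducesPrime 3 ι' 𝔮 →
                ∃ (θsub θquot θ₀ : FramedGaloisRep K (padicCoeffIntegers (∅ : Set (PadicAlgCl 3))) 1)
                  (θ₀K : HeckeCharacter K) (Cbar : Finset (HeightOneSpectrum (𝓞 K)))
                  (ΩK₀ : ℂ) (Ωp₀ : (unrIntegers 3)ˣ) (Lφ : UnrSeries 3) (nφ : ℕ),
                  IsResidualPairOver (W.baseChange K) 3 θsub θquot ∧ (θ₀ = θsub ∨ θ₀ = θquot) ∧
                    IsHeckeCharOf ι' θ₀ θ₀K ∧ θ₀K.IsUnramifiedAt 𝔮 ∧ θ₀K.IsUnramifiedAt 𝔭 ∧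
                    (∀ u ∈ Cbar, ¬ θ₀K.IsUnramifiedAt u) ∧ ΩK₀ ≠ 0 ∧
                    IsKatzLFunction ι' 𝔮 𝔭 Cbar κ γ θ₀K ΩK₀ ((Ωp₀ : unrIntegers 3) : ℂ_[3]) Lφ ∧
                    FirstUnitCoeffAt Lφ nφ ∧
                    ∀ θ : FramedGaloisRep K (padicCoeffIntegers (∅ : Set (PadicAlgCl 3))) 1, (θ = θsub ∨ θ = θquot) →
                      ∀ G : GrDualData κ (charModule (∅ : Set (PadicAlgCl 3)) θ) 𝔭 (∅ : Set (HeightOneSpectrum (𝓞 K))) γ,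
                        lambdaInvariant 3 G.X = nφ) →
            AdditiveIMCLowerBDPOnTreeLeAt 3 κ 𝔭 γ (embAt K 3 𝔭 h𝔭 he hf) (padicValNat 3 Dt.c.natAbs) P := by
  intro W _ _ hr hX hS hna hlat
  have hp2 : (3 : ℕ) ≠ 2 := by norm_num
  obtain ⟨W', hE', hmin', C₂, hW, hord, hΔ⟩ :=
    exists_goodOrd_partner_presentation_of_subGordTwo_odd hp2 W hX hS
  subst hW
  haveI : NeZero (W'.conductorNorm ℤ) := ⟨(WeierstrassCurve.conductorNorm_pos_holds W').ne'⟩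
  intro N _ K _ _ Dt H ι P hr' hloc hN hK hodd hunit hHe hL1 hP hnt hdK htf κ hκ γ _ 𝔭 h𝔭 he hf hAUX
  refine additiveIMCLowerBDPOnTreeLeAt_of_kolyvagin_of_hsieh_of_lzz_of_intDivConj hKo hA hL hp2 hX (Or.inr hS) Dt H ι P
    hr' hloc hN hK hodd hunit hHe hL1 hP hnt κ hκ γ 𝔭 h𝔭 he hf ?_
  intro 𝔮 h𝔮 hne he' hf' ι' hι' ΩK Ωp Q hΩK hΩp hQ
  obtain ⟨Dt'⟩ := hPar W'
  haveI : IsGalois ℚ K := Literature.FieldTheory.Galois.isGalois_of_finrank_eq_two hK.1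
  have hpN' : ¬ 3 ∣ W'.conductorNorm ℤ := not_dvd_conductorNorm_of_hasGoodReductionAtPrime W' hord.1
  have hmodN : exists_isNewformOf := exists_isNewformOf_of_nonempty_modularParametrizationData hPar
  have hHe' : SatisfiesHeegnerHypothesis (W'.conductorNorm ℤ) K :=
    SatisfiesHeegnerHypothesis.of_dvd (conductorNorm_partner_dvd_level hmodN hp2 W' hord.1 _ C₂ Dt) hHe
  -- Case (I) for the curve itself, from the cell
  have hcase := hasGoodOrdinaryReductionOverQuadraticAt_of_subGordTwo hp2 _ hX hS
  -- the comparison data at `(𝔮, ι′)`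
  obtain ⟨θsub, θquot, θ₀, θ₀K, Cbar, ΩK₀, Ωp₀, Lφ, nφ, hpair, hθ₀, hθ₀K, hv0, hvbar0, hCbar, hΩK₀, hLφ, hnφ, hchar⟩ :=
    hAUX 𝔮 h𝔮 hne ι' hι'
  exact KYBranchThreeBROfTree.xac_charIdeal_map_le_span_three_self_of_dvd hCHσ hDVD hAN hprop125 hge hfact hlift hlocal hPT hmodN
    W' hord.1 _ C₂ Dt Dt' hpN' hK hHe hHe' hodd hdK hκ γ h𝔭 he hf h𝔮 hne hι' hN hcase hX hS hna hlat htf hpair hθ₀ hθ₀K hv0 hvbar0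
    hCbar hΩK₀ hLφ hnφ hchar hΩK hΩp hQ

/-- **The same with the lattice normalisation `hlat` DISCHARGED** (generation 26's `KYBranchThreeLattice.…_of_torsionFree`, Greenberg-free, [BR3]-free): the only per-curve
hypothesis still displayed is `W(K)[3] = 0`. [claim: KellerYin2024PotOrd, status: under-review]
[cite: KellerYin2024b, §2.0 standing lattice hypothesis and Thm. 3.5.1 (arXiv:2410.23241 pp. 8, 20)] [cite: CastellaGrossiLeeSkinner2022, Props. 1.2.5, 14] [cite: MilneADT2006, I Thm. 4.10 (a)] -/
theorem additiveIMCLowerBDPOnTree_subGordTwo_three_offSliver_of_torsionFree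
    (hKo : ∀ (N : ℕ) [NeZero N] (W : WeierstrassCurve ℚ) (K : Type) [Field K] [NumberField K],
      Literature.NumberTheory.EllipticCurves.kolyvagin N W K)
    (hPar : nonempty_modularParametrizationData)
    (hA : Hsieh2014.thmA_exists_isHsiehLFunction_unrPeriod_anyLevel)
    (hL : LiuZhangZhang2018.thm151_thm153_modularCurve_heegnerVector_additive)
    (hCHσ : castellaHsieh2018_exists_isBranchBDPLFunction_signed)
    (hDVD : thm336_dvd_branch_OPEN) (hAN : thm351_anacong_branch_three)
    (hprop125 : prop125_characterGrSelmerDual_torsion_muZero_dim) (hge : prop125_characterGrSelmerDual_corank_ge) (hfact : prop14_residualCharacterSelmer_finite)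
    (hlift : cor126_residualCharacter_globalLift) (hlocal : cor126_residualCharacter_localSurjective)
    (hPT : ∀ (L : Type) [Field L] [NumberField L] [IsTotallyComplex L] (S : Set (HeightOneSpectrum (𝓞 L))),
      S.Finite → Literature.NumberTheory.GaloisCohomology.poitouTate_shaRestricted_tateDual_natural_at L S) :
    ∀ (W : WeierstrassCurve ℚ) [W.IsElliptic] [W.IsGloballyMinimal],
      W.analyticRank = 1 → ClassX3 W 3 → SubGordTwo W 3 →
      (∀ (V : WeierstrassCurve ℚ) [V.IsElliptic] [V.IsGloballyMinimal] (C : VariableChange ℚ),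
        GoodOrd V 3 → C • V.quadraticTwist ((-1 : ℚ) ^ (3 / 2) * (3 : ℕ)) = W → ¬ (3 : ℤ) ∣ V.frobeniusTrace 3 - 1) →
      ∀ (N : ℕ) [NeZero N] (K : Type) [Field K] [NumberField K]
        (Dt : ModularParametrizationData W N) (H : HeegnerDatum N (NumberField.discr K)) (ι : K →+* ℂ)
        (P : (W.baseChange K).toAffine.Point),
        W.analyticRank = 1 → Additive.N10.Locus W 3 → W.conductorNorm ℤ = N → IsImaginaryQuadratic K →
        Odd (NumberField.discr K) → ¬ 3 ∣ Units.torsionOrder K → SatisfiesHeegnerHypothesis N K →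
        (W.quadraticTwist (NumberField.discr K : ℚ)).entireLFunction 1 ≠ 0 →
        WeierstrassCurve.Affine.Point.map ι.toRatAlgHom P = heegnerPointComplex Dt H →
        ¬ IsOfFinAddOrder P → NumberField.discr K ≠ -3 →
        (∀ Q : (W.baseChange K).toAffine.Point, 3 • Q = 0 → Q = 0) →
        ∀ (κ : ZpExtension K 3), κ.IsAnticyclotomic →
          ∀ (γ : Field.absoluteGaloisGroup K) [Fact (κ.IsTopGenerator γ)]
            (𝔭 : HeightOneSpectrum (𝓞 K)) (h𝔭 : ((3 : ℕ) : 𝓞 K) ∈ 𝔭.asIdeal)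
            (he : 𝔭.asIdeal.ramificationIdx (𝓞 ℚ) = 1) (hf : 𝔭.asIdeal.inertiaDeg (𝓞 ℚ) = 1),
            (∀ (𝔮 : HeightOneSpectrum (𝓞 K)), ((3 : ℕ) : 𝓞 K) ∈ 𝔮.asIdeal → 𝔭 ≠ 𝔮 →
              ∀ (ι' : PadicAlgCl 3 ≃+* ℂ), BranchInducesPrime 3 ι' 𝔮 →
                ∃ (θsub θquot θ₀ : FramedGaloisRep K (padicCoeffIntegers (∅ : Set (PadicAlgCl 3))) 1)
                  (θ₀K : HeckeCharacter K) (Cbar : Finset (HeightOneSpectrum (𝓞 K)))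
                  (ΩK₀ : ℂ) (Ωp₀ : (unrIntegers 3)ˣ) (Lφ : UnrSeries 3) (nφ : ℕ),
                  IsResidualPairOver (W.baseChange K) 3 θsub θquot ∧ (θ₀ = θsub ∨ θ₀ = θquot) ∧
                    IsHeckeCharOf ι' θ₀ θ₀K ∧ θ₀K.IsUnramifiedAt 𝔮 ∧ θ₀K.IsUnramifiedAt 𝔭 ∧
                    (∀ u ∈ Cbar, ¬ θ₀K.IsUnramifiedAt u) ∧ ΩK₀ ≠ 0 ∧
                    IsKatzLFunction ι' 𝔮 𝔭 Cbar κ γ θ₀K ΩK₀ ((Ωp₀ : unrIntegers 3) : ℂ_[3]) Lφ ∧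
                    FirstUnitCoeffAt Lφ nφ ∧
                    ∀ θ : FramedGaloisRep K (padicCoeffIntegers (∅ : Set (PadicAlgCl 3))) 1, (θ = θsub ∨ θ = θquot) →
                      ∀ G : GrDualData κ (charModule (∅ : Set (PadicAlgCl 3)) θ) 𝔭 (∅ : Set (HeightOneSpectrum (𝓞 K))) γ,
                        lambdaInvariant 3 G.X = nφ) →
            AdditiveIMCLowerBDPOnTreeLeAt 3 κ 𝔭 γ (embAt K 3 𝔭 h𝔭 he hf) (padicValNat 3 Dt.c.natAbs) P := by
  intro W _ _ hr hX hS hna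
  exact additiveIMCLowerBDPOnTree_subGordTwo_three_offSliver_self hKo hPar hA hL hCHσ hDVD hAN hprop125 hge hfact hlift hlocal
    hPT W hr hX hS hna
    (KYBranchThreeLattice.exists_isRationalLine_not_lineDecompositionTrivialAt_of_subGordTwo_of_forall_twist_three W hX hS hna)

/-- **The (G-ord, `e = 2`) LOWER socket AT `p = 3`, off the `d_K = −3` sliver, non-anomalous twists, per Heegner datum — for EVERY globally minimal curve of the cell,
Greenberg-free and [BR3]-free** (generation 27's `KYBranchThreeTorsion.…three_offSliver`: `W(K)[3] = 0` from the non-anomalous clause), the comparison datum displayed.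
[claim: KellerYin2024PotOrd, status: under-review] [cite: KellerYin2024b, Thm. 3.5.1, Assumption 2.0.3 (arXiv:2410.23241 pp. 8, 20)]
[cite: CastellaGrossiLeeSkinner2022, Props. 1.2.5, 14, Thm. 2.1.2] [cite: MilneADT2006, I Thm. 4.10 (a)] -/
theorem additiveIMCLowerBDPOnTree_subGordTwo_three_offSliver
    (hKo : ∀ (N : ℕ) [NeZero N] (W : WeierstrassCurve ℚ) (K : Type) [Field K] [NumberField K],
      Literature.NumberTheory.EllipticCurves.kolyvagin N W K)
    (hPar : nonempty_modularParametrizationData)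
    (hA : Hsieh2014.thmA_exists_isHsiehLFunction_unrPeriod_anyLevel)
    (hL : LiuZhangZhang2018.thm151_thm153_modularCurve_heegnerVector_additive)
    (hCHσ : castellaHsieh2018_exists_isBranchBDPLFunction_signed)
    (hDVD : thm336_dvd_branch_OPEN) (hAN : thm351_anacong_branch_three)
    (hprop125 : prop125_characterGrSelmerDual_torsion_muZero_dim) (hge : prop125_characterGrSelmerDual_corank_ge) (hfact : prop14_residualCharacterSelmer_finite)
    (hlift : cor126_residualCharacter_globalLift) (hlocal : cor126_residualCharacter_localSurjective)
    (hPT : ∀ (L : Type) [Field L] [NumberField L] [IsTotallyComplex L] (S : Set (HeightOneSpectrum (𝓞 L))),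
      S.Finite → Literature.NumberTheory.GaloisCohomology.poitouTate_shaRestricted_tateDual_natural_at L S) :
    ∀ (W : WeierstrassCurve ℚ) [W.IsElliptic] [W.IsGloballyMinimal],
      W.analyticRank = 1 → ClassX3 W 3 → SubGordTwo W 3 →
      (∀ (V : WeierstrassCurve ℚ) [V.IsElliptic] [V.IsGloballyMinimal] (C : VariableChange ℚ),
        GoodOrd V 3 → C • V.quadraticTwist ((-1 : ℚ) ^ (3 / 2) * (3 : ℕ)) = W → ¬ (3 : ℤ) ∣ V.frobeniusTrace 3 - 1) →
      ∀ (N : ℕ) [NeZero N] (K : Type) [Field K] [NumberField K]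
        (Dt : ModularParametrizationData W N) (H : HeegnerDatum N (NumberField.discr K)) (ι : K →+* ℂ)
        (P : (W.baseChange K).toAffine.Point),
        W.analyticRank = 1 → Additive.N10.Locus W 3 → W.conductorNorm ℤ = N → IsImaginaryQuadratic K →
        Odd (NumberField.discr K) → ¬ 3 ∣ Units.torsionOrder K → SatisfiesHeegnerHypothesis N K →
        (W.quadraticTwist (NumberField.discr K : ℚ)).entireLFunction 1 ≠ 0 →
        WeierstrassCurve.Affine.Point.map ι.toRatAlgHom P = heegnerPointComplex Dt H →
        ¬ IsOfFinAddOrder P → NumberField.discr K ≠ -3 →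
        ∀ (κ : ZpExtension K 3), κ.IsAnticyclotomic →
          ∀ (γ : Field.absoluteGaloisGroup K) [Fact (κ.IsTopGenerator γ)]
            (𝔭 : HeightOneSpectrum (𝓞 K)) (h𝔭 : ((3 : ℕ) : 𝓞 K) ∈ 𝔭.asIdeal)
            (he : 𝔭.asIdeal.ramificationIdx (𝓞 ℚ) = 1) (hf : 𝔭.asIdeal.inertiaDeg (𝓞 ℚ) = 1),
            (∀ (𝔮 : HeightOneSpectrum (𝓞 K)), ((3 : ℕ) : 𝓞 K) ∈ 𝔮.asIdeal → 𝔭 ≠ 𝔮 →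
              ∀ (ι' : PadicAlgCl 3 ≃+* ℂ), BranchInducesPrime 3 ι' 𝔮 →
                ∃ (θsub θquot θ₀ : FramedGaloisRep K (padicCoeffIntegers (∅ : Set (PadicAlgCl 3))) 1)
                  (θ₀K : HeckeCharacter K) (Cbar : Finset (HeightOneSpectrum (𝓞 K)))
                  (ΩK₀ : ℂ) (Ωp₀ : (unrIntegers 3)ˣ) (Lφ : UnrSeries 3) (nφ : ℕ),
                  IsResidualPairOver (W.baseChange K) 3 θsub θquot ∧ (θ₀ = θsub ∨ θ₀ = θquot) ∧
                    IsHeckeCharOf ι' θ₀ θ₀K ∧ θ₀K.IsUnramifiedAt 𝔮 ∧ θ₀K.IsUnramifiedAt 𝔭 ∧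
                    (∀ u ∈ Cbar, ¬ θ₀K.IsUnramifiedAt u) ∧ ΩK₀ ≠ 0 ∧
                    IsKatzLFunction ι' 𝔮 𝔭 Cbar κ γ θ₀K ΩK₀ ((Ωp₀ : unrIntegers 3) : ℂ_[3]) Lφ ∧
                    FirstUnitCoeffAt Lφ nφ ∧
                    ∀ θ : FramedGaloisRep K (padicCoeffIntegers (∅ : Set (PadicAlgCl 3))) 1, (θ = θsub ∨ θ = θquot) →
                      ∀ G : GrDualData κ (charModule (∅ : Set (PadicAlgCl 3)) θ) 𝔭 (∅ : Set (HeightOneSpectrum (𝓞 K))) γ,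
                        lambdaInvariant 3 G.X = nφ) →
            AdditiveIMCLowerBDPOnTreeLeAt 3 κ 𝔭 γ (embAt K 3 𝔭 h𝔭 he hf) (padicValNat 3 Dt.c.natAbs) P := by
  intro W _ _ hr hX hS hna N _ K _ _ Dt H ι P hr' hloc hN hK hodd hunit hHe hL1 hP hnt hdK κ hκ γ _ 𝔭 h𝔭 he hf hAUX
  -- `3 ∣ N` (additive reduction), so `3` splits in the Heegner field `K`
  have haddv : Addv W 3 := hloc.2.1
  have h9N : 3 ^ 2 ∣ N := by
    by_contra h
    rw [← hN] at h
    rcases hasGoodReductionAtPrime_or_hasMultiplicativeReductionAtPrime_of_not_sq_dvd_conductorNorm (V := W) h with hg | hm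
    · exact haddv.1 hg
    · exact haddv.2 hm
  have hsplit : ((Ideal.span {((3 : ℕ) : ℤ)}).primesOver (𝓞 K)).ncard = 2 :=
    hHe 3 Nat.prime_three (dvd_trans (dvd_pow_self 3 two_ne_zero) h9N)
  -- `W(K)[3] = 0` (§4) from the non-anomalous clause
  have htf : ∀ Q : (W.baseChange K).toAffine.Point, 3 • Q = 0 → Q = 0 := fun Q hQ ↦
    KYBranchThreeTorsion.forall_baseChange_nsmul_eq_zero_of_hna (p := 3) (by norm_num)
      (hna_isRationalLine_of_subGordTwo_of_forall_twist W (by norm_num) hX hS hna) hK.1 hsplit Q hQ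
  exact additiveIMCLowerBDPOnTree_subGordTwo_three_offSliver_of_torsionFree hKo hPar hA hL hCHσ hDVD hAN hprop125 hge hfact hlift hlocal hPT W hr hX hS hna N K Dt H ι P hr' hloc hN hK hodd hunit hHe hL1 hP hnt hdK htf κ hκ γ 𝔭 h𝔭 he hf hAUX

/-- **The same with NO existence hypothesis left AND NO [BR3]** (generation 27's `KYBranchThreeAux.…_of_thm212`, Greenberg-free): the comparison datum (a member of the Teichmüller pair
unramified at `3` with its Katz frame) from CGLS Thm. 2.1.2 `h212`, ITS Rubin–Hida λ-clauses from cell `bsd-eis`'s [BR𝟙]/[BRω] roads on the tree's Milne ADT I 4.10 (a)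
(Bleher et al. 3.3.1 `h331`, de Shalit II.6.4 `hFE`, Hida Thm. I `hO1`) transferred to the strict duals — FILE 1's AUX3-BR `KYBranchThreeBROfTree.exists_aux3br_of_thm212`.
[cite: BleherEtAl2020, §3.3 Thm. 3.3.1] [cite: deShalit1987, II.6.4] [cite: Hida2010MuInvariant, Thm. I] [claim: KellerYin2024PotOrd, status: under-review]
[cite: KellerYin2024b, Thm. 3.5.1 (arXiv:2410.23241 p. 20)] [cite: CastellaGrossiLeeSkinner2022, Thm. 2.1.2, Props. 1.2.5, 14] [cite: MilneADT2006, I Thm. 4.10 (a)] -/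
theorem additiveIMCLowerBDPOnTree_subGordTwo_three_offSliver_of_thm212
    (hKo : ∀ (N : ℕ) [NeZero N] (W : WeierstrassCurve ℚ) (K : Type) [Field K] [NumberField K],
      Literature.NumberTheory.EllipticCurves.kolyvagin N W K)
    (hPar : nonempty_modularParametrizationData)
    (hA : Hsieh2014.thmA_exists_isHsiehLFunction_unrPeriod_anyLevel)
    (hL : LiuZhangZhang2018.thm151_thm153_modularCurve_heegnerVector_additive)
    (hCHσ : castellaHsieh2018_exists_isBranchBDPLFunction_signed)
    (hDVD : thm336_dvd_branch_OPEN) (hAN : thm351_anacong_branch_three)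
    (h212 : thm212_exists_isKatzLFunction)
    (h331 : thm331_rubin_exists_katzMeasure₂_pseudoIso_span_eq)
    (hFE : thmII64_katzMeasure₂_functionalEquation) (hO1 : thmI_mu_katzBranch_reflect_eq_zero)
    (hprop125 : prop125_characterGrSelmerDual_torsion_muZero_dim) (hge : prop125_characterGrSelmerDual_corank_ge) (hfact : prop14_residualCharacterSelmer_finite)
    (hlift : cor126_residualCharacter_globalLift) (hlocal : cor126_residualCharacter_localSurjective)
    (hPT : ∀ (L : Type) [Field L] [NumberField L] [IsTotallyComplex L] (S : Set (HeightOneSpectrum (𝓞 L))),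
      S.Finite → Literature.NumberTheory.GaloisCohomology.poitouTate_shaRestricted_tateDual_natural_at L S) :
    ∀ (W : WeierstrassCurve ℚ) [W.IsElliptic] [W.IsGloballyMinimal],
      W.analyticRank = 1 → ClassX3 W 3 → SubGordTwo W 3 →
      (∀ (V : WeierstrassCurve ℚ) [V.IsElliptic] [V.IsGloballyMinimal] (C : VariableChange ℚ),
        GoodOrd V 3 → C • V.quadraticTwist ((-1 : ℚ) ^ (3 / 2) * (3 : ℕ)) = W → ¬ (3 : ℤ) ∣ V.frobeniusTrace 3 - 1) →
      ∀ (N : ℕ) [NeZero N] (K : Type) [Field K] [NumberField K]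
        (Dt : ModularParametrizationData W N) (H : HeegnerDatum N (NumberField.discr K)) (ι : K →+* ℂ)
        (P : (W.baseChange K).toAffine.Point),
        W.analyticRank = 1 → Additive.N10.Locus W 3 → W.conductorNorm ℤ = N → IsImaginaryQuadratic K →
        Odd (NumberField.discr K) → ¬ 3 ∣ Units.torsionOrder K → SatisfiesHeegnerHypothesis N K →
        (W.quadraticTwist (NumberField.discr K : ℚ)).entireLFunction 1 ≠ 0 →
        WeierstrassCurve.Affine.Point.map ι.toRatAlgHom P = heegnerPointComplex Dt H →
        ¬ IsOfFinAddOrder P → NumberField.discr K ≠ -3 →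
        ∀ (κ : ZpExtension K 3), κ.IsAnticyclotomic →
          ∀ (γ : Field.absoluteGaloisGroup K) [Fact (κ.IsTopGenerator γ)]
            (𝔭 : HeightOneSpectrum (𝓞 K)) (h𝔭 : ((3 : ℕ) : 𝓞 K) ∈ 𝔭.asIdeal)
            (he : 𝔭.asIdeal.ramificationIdx (𝓞 ℚ) = 1) (hf : 𝔭.asIdeal.inertiaDeg (𝓞 ℚ) = 1),
            AdditiveIMCLowerBDPOnTreeLeAt 3 κ 𝔭 γ (embAt K 3 𝔭 h𝔭 he hf) (padicValNat 3 Dt.c.natAbs) P := by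
  intro W _ _ hr hX hS hna N _ K _ _ Dt H ι P hr' hloc hN hK hodd hunit hHe hL1 hP hnt hdK κ hκ γ _ 𝔭 h𝔭 he hf
  exact additiveIMCLowerBDPOnTree_subGordTwo_three_offSliver hKo hPar hA hL hCHσ hDVD hAN hprop125 hge hfact hlift hlocal hPT W hr hX hS hna N K Dt H ι P hr' hloc hN hK hodd hunit hHe hL1 hP hnt hdK κ hκ γ 𝔭 h𝔭 he hf
    (fun 𝔮 h𝔮 hne ι' hι' ↦ KYBranchThreeBROfTree.exists_aux3br_of_thm212 h212 h331 hFE hO1 W hX hS hna hN hK hHe hodd hdK hκ γ h𝔭 he hf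
      h𝔮 hne hι')

/-- **Crux r3's own currency `AdditiveIMCLowerBDPInputManinAt W 3` on the (G-ord, `e = 2`) pairs with NON-ANOMALOUS twists, Greenberg-free and [BR3]-free** ⟸ Kolyvagin ∧ Par ∧ Hsieh A ∧
LZZ ∧ Castella–Hsieh signed ∧ [DIV.dvd] ∧ [AN3] ∧ CGLS Thm. 2.1.2 ∧ Bleher et al. 3.3.1 ∧ de Shalit II.6.4 ∧ Hida Thm. I ∧ CGLS Prop. 1.2.5 (module + corank clauses), Prop. 14,
Cor. 1.2.6 ×2 ∧ Milne I 4.10 (a) — generation 27's `additiveIMCLowerBDPInputManinAt_gordTwo_three_of_print_of_forall_twist` re-typed (the sliver is void at `3`); the Rubin–Hida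
input is now the three refereed statements the ANOMALOUS column already displays, not the named fact [BR3].
[cite: BleherEtAl2020, §3.3 Thm. 3.3.1] [cite: deShalit1987, II.6.4] [cite: Hida2010MuInvariant, Thm. I] [claim: KellerYin2024PotOrd, status: under-review]
[cite: KellerYin2024b, Thm. 3.3.6, Prop. 3.4.4, §3.5, Thm. 3.5.1 (arXiv:2410.23241 pp. 19–20) (preprint)] [cite: CastellaGrossiLeeSkinner2022, Thms. 1.2.2, 2.1.2, 2.2.2, Props. 1.2.5, 14, Cor. 1.2.6]
[cite: CastellaHsieh2018, §3.3, Def. 3.7, Prop. 3.8] [cite: Hsieh2014, Thm. A] [cite: LiuZhangZhang2018, Thms. 1.5.1/1.5.3] [cite: MilneADT2006, I Thm. 4.10 (a)] -/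
theorem additiveIMCLowerBDPInputManinAt_gordTwo_three_of_print_of_forall_twist
    (hKo : ∀ (N : ℕ) [NeZero N] (W : WeierstrassCurve ℚ) (K : Type) [Field K] [NumberField K],
      Literature.NumberTheory.EllipticCurves.kolyvagin N W K)
    (hPar : nonempty_modularParametrizationData)
    (hA : Hsieh2014.thmA_exists_isHsiehLFunction_unrPeriod_anyLevel)
    (hL : LiuZhangZhang2018.thm151_thm153_modularCurve_heegnerVector_additive)
    (hCHσ : castellaHsieh2018_exists_isBranchBDPLFunction_signed)
    (hDVD : thm336_dvd_branch_OPEN) (hAN : thm351_anacong_branch_three)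
    (h212 : thm212_exists_isKatzLFunction)
    (h331 : thm331_rubin_exists_katzMeasure₂_pseudoIso_span_eq)
    (hFE : thmII64_katzMeasure₂_functionalEquation) (hO1 : thmI_mu_katzBranch_reflect_eq_zero)
    (hprop125 : prop125_characterGrSelmerDual_torsion_muZero_dim) (hge : prop125_characterGrSelmerDual_corank_ge) (hfact : prop14_residualCharacterSelmer_finite)
    (hlift : cor126_residualCharacter_globalLift) (hlocal : cor126_residualCharacter_localSurjective)
    (hPT : ∀ (L : Type) [Field L] [NumberField L] [IsTotallyComplex L] (S : Set (HeightOneSpectrum (𝓞 L))),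
      S.Finite → Literature.NumberTheory.GaloisCohomology.poitouTate_shaRestricted_tateDual_natural_at L S) :
    ∀ (W : WeierstrassCurve ℚ) [W.IsElliptic] [W.IsGloballyMinimal],
      W.analyticRank = 1 → ClassX3 W 3 → Additive.SubGordTwo W 3 →
      (∀ (V : WeierstrassCurve ℚ) [V.IsElliptic] [V.IsGloballyMinimal] (C : VariableChange ℚ),
        GoodOrd V 3 → C • V.quadraticTwist ((-1 : ℚ) ^ (3 / 2) * (3 : ℕ)) = W → ¬ (3 : ℤ) ∣ V.frobeniusTrace 3 - 1) →
      AdditiveIMCLowerBDPInputManinAt W 3 := by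
  intro W _ _ hr hX hS hna N _ K _ _ Dt H ι P hr' hloc hN hK hodd hunit hHe hL1 hP hnt κ hκ γ _ 𝔭 h𝔭 he hf
  -- the `d_K = −3` sliver is void at `p = 3`
  have hdK : NumberField.discr K ≠ -3 := fun hd ↦ sliver_void_at_three hK hd rfl hunit
  exact additiveIMCLowerBDPOnTree_subGordTwo_three_offSliver_of_thm212 hKo hPar hA hL hCHσ hDVD hAN h212 h331 hFE hO1 hprop125 hge hfact hlift hlocal hPT W hr hX hS hna N K Dt H ι P hr' hloc hN hK hodd hunit hHe hL1 hP hnt hdK κ hκ γ 𝔭 h𝔭 he hf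

end Summit.BirchSwinnertonDyer.BirchSwinnertonDyer.Theorems.SchneiderFreeAdditiveX3.KYBranchThreeDoorBROfTree

end
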